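import Literature.Computability.MetaComplexity.ConstructiveSeparations
import Literature.Computability.Complexity.SearchToDecisionBPP
import Literature.Computability.Complexity.ExpClosure
import Literature.Computability.Complexity.BPClosureProofs
import Literature.Computability.Complexity.UniformDerandomizationEndgame
import HarnessLib

/-!
# Refuters for `EXP` against `BPP` (Chen–Jin–Santhanam–Williams, Thm. 1.2), I: closure tools

Topic `Literature/Computability/MetaComplexity`. First of the proof files discharging the named
fact `constructiveSeparation_of_not_subset_BPP_EXP` of `ConstructiveSeparations.lean`
(L. Chen, C. Jin, R. Santhanam, R. Williams, *Constructive separations and their consequences*,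
FOCS 2021 / TheoretiCS 2024, Thm. 1.2 for `(𝒞, 𝒟) = (BPP, EXP)`, proved in §5.1 of arXiv:2203.14379v5 as Thm. 5.4
("Refuters for PSPACE, EXP and NEXP") together with the lemma converting constant-size list-refuters
into refuters [ChenEtAl2022]). This file supplies the two structural ingredients the printed
proof takes for granted:

* **Boolean closure of `EXP` through a complete set** (`inter_mem_EXP_of_complete`,
  `union_mem_EXP_of_complete`, `setOf_iff_not_mem_EXP_of_complete`): both languages Karp-reduce
  to the complete `B`, and `x ∈ L₁ ∩ L₂` iff `⟨x, y⟩ ∈ V` for BOTH `y ∈ {ε, 1}`, where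
  `V = g⁻¹(B)` asks `f₁ x` on `⟨x, ε⟩` and `f₂ x` otherwise — a polynomially bounded `∀` over an
  `EXP` matrix (`polyForall_EXP_subset_EXP`, `ExpClosure.lean`). (The printed proof uses
  "`G_A = G_A^{(0)} ∪ G_A^{(1)}`, decided with two queries to the `L`-oracle".)
* **The prefix-search language is in `EXP`** (`prefLang`, `boolPair_mem_prefLang`,
  `prefLang_mem_EXP`): for `S ∈ EXP`,
  `G_S = {⟨u, w⟩ | ∃ v, |v ++ w| = |u| ∧ v ++ w ∈ S} ∈ ∃ᵖ·EXP ⊆ EXP` — the printed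
  `G_A = {(1ⁿ, x) : some y ∈ {0,1}ⁿ with prefix x has L(y) ≠ A(y)}` with `S = L ∆ L(A)`, prefixes
  replaced by suffixes (the tree's search transducers prepend; immaterial).
* **Infinitely many bad input lengths** (`frequently_exists_mismatch`): if `EXP ⊄ BPP`, `L` is
  `EXP`-complete and length-paddable and `L'' ∈ BPP`, then for infinitely many `n` some `n`-bit
  string lies in `L ∆ L''` — the printed "since `𝒟 ⊄ 𝒞`, there are infinitely many such input
  lengths": otherwise padding every reduction `f` to length `|f x| + n₀` Karp-reduces all of `EXP`
  to `L'' ∈ BPP` (`mem_BPP_of_karpReducible`).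
* `padStr`, `padStr_mem_FP`: the padding map of `IsLengthPaddable` as an `FP` string function
  `⟨x, r⟩ ↦ pad(x, |r|)` (`mem_FP_of_unaryArg`).

## References

* [ChenEtAl2022] L. Chen, C. Jin, R. Santhanam, R. Williams, *Constructive separations and their
  consequences*, FOCS 2021, pp. 646–657; arXiv:2203.14379v5, §5.1 (Thm. 5.4 and the list-refuter lemma preceding it).
* [AroraBarakCC2009] S. Arora, B. Barak, *Computational Complexity: A Modern Approach*, CUP 2009,
  §2.6.2 (`EXP`), Claim 2.4 (exhaustive search), Thm. 2.8 (closure under reductions), §7.6.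
-/

namespace Literature.Computability.MetaComplexity

open _root_.Computability Complexity Filter Polynomial

/-! ### Boolean closure of `EXP` through a complete set -/

section ExpBool

variable {B : Language Bool}

/-- The two-query selector: on `⟨x, y⟩` return `f₁ x` if `y = ε` and `f₂ x` otherwise
(`iteFn` on the indicator of the `P`-language `{z | sndP z = ε}`). [folklore] -/
theorem exists_twoQuery {f₁ f₂ : List Bool → List Bool} (hf₁ : f₁ ∈ FP) (hf₂ : f₂ ∈ FP) :
    ∃ g ∈ FP, (∀ x : List Bool, g (boolPair x []) = f₁ x) ∧
      ∀ (x : List Bool) (b : Bool) (y : List Bool), g (boolPair x (b :: y)) = f₂ x := by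
  set E : Language Bool := {z | sndP z = (fun _ : List Bool => ([] : List Bool)) z} with hE
  have hEP : E ∈ Classes.P := setOf_apply_eq_apply_mem_P sndP_mem_FP (const_mem_FP [])
  set c : List Bool → List Bool := fun z => encodeBool (E.boolIndicator z) with hc
  have hcFP : c ∈ FP := indicatorFn_mem_FP hEP
  refine ⟨iteFn c (f₁ ∘ fstP) (f₂ ∘ fstP),
    iteFn_mem_FP hcFP (comp_mem_FP hf₁ fstP_mem_FP) (comp_mem_FP hf₂ fstP_mem_FP),
    fun x => ?_, fun x b y => ?_⟩
  · have hm : boolPair x [] ∈ E := by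
      show sndP (boolPair x []) = []
      rw [sndP_boolPair]
    have hcz : c (boolPair x []) = [true] := by
      simp only [hc, (Set.mem_iff_boolIndicator _ _).1 hm]
      rfl
    rw [iteFn_apply_true hcz, Function.comp_apply, fstP_boolPair]
  · have hm : boolPair x (b :: y) ∉ E := by
      show ¬ sndP (boolPair x (b :: y)) = []
      rw [sndP_boolPair]
      exact List.cons_ne_nil b y
    have hcz : c (boolPair x (b :: y)) = [false] := by
      simp only [hc, (Set.notMem_iff_boolIndicator _ _).1 hm]
      rfl
    rw [iteFn_apply_false hcz, Function.comp_apply, fstP_boolPair]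

/-- **The intersection of two `EXP` languages is in `EXP`** (given a Karp-`EXP`-complete `B`):
with reductions `f₁`, `f₂` to `B` and the two-query selector `g`, `L₁ ∩ L₂` is the polynomially
bounded universal quantifier `{x | ∀ y, |y| ≤ 1 → ⟨x, y⟩ ∈ g⁻¹(B)}` over the `EXP` matrix
`g⁻¹(B)`, hence in `∀ᵖ·EXP ⊆ EXP`. (The device behind "decide `G_A = G_A^{(0)} ∪ G_A^{(1)}`
by making two queries to an oracle for `L`" in the printed proof of [ChenEtAl2022], §5.1.) [folklore] -/
theorem inter_mem_EXP_of_complete (hB : IsComplete EXP B) {L₁ L₂ : Language Bool}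
    (h₁ : L₁ ∈ EXP) (h₂ : L₂ ∈ EXP) : L₁ ⊓ L₂ ∈ EXP := by
  obtain ⟨f₁, hf₁, hr₁⟩ := hB.2 L₁ h₁
  obtain ⟨f₂, hf₂, hr₂⟩ := hB.2 L₂ h₂
  obtain ⟨g, hg, hg₁, hg₂⟩ := exists_twoQuery hf₁ hf₂
  have hV : (g ⁻¹' B : Language Bool) ∈ EXP := preimage_mem_EXP_of_mem_FP hB.1 hg
  refine polyForall_EXP_subset_EXP (mem_polyForall_iff.2 ⟨g ⁻¹' B, hV, 1, fun x => ?_⟩)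
  constructor
  · rintro ⟨hx₁, hx₂⟩ y hy
    rw [eval_one] at hy
    show g (boolPair x y) ∈ B
    rcases y with _ | ⟨b, y⟩
    · rw [hg₁]
      exact (hr₁ x).1 hx₁
    · rw [hg₂]
      exact (hr₂ x).1 hx₂
  · intro h
    have e₁ : g (boolPair x []) ∈ B := h [] (by simp)
    have e₂ : g (boolPair x [true]) ∈ B := h [true] (by simp)
    rw [hg₁] at e₁
    rw [hg₂] at e₂
    exact ⟨(hr₁ x).2 e₁, (hr₂ x).2 e₂⟩

/-- **The union of two `EXP` languages is in `EXP`** (given a Karp-`EXP`-complete `B`), by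
De Morgan from `inter_mem_EXP_of_complete` and `compl_mem_EXP_iff`. [folklore] -/
theorem union_mem_EXP_of_complete (hB : IsComplete EXP B) {L₁ L₂ : Language Bool}
    (h₁ : L₁ ∈ EXP) (h₂ : L₂ ∈ EXP) : L₁ ⊔ L₂ ∈ EXP := by
  have h := inter_mem_EXP_of_complete hB (compl_mem_EXP_iff.2 h₁) (compl_mem_EXP_iff.2 h₂)
  rw [← compl_mem_EXP_iff, compl_inf, compl_compl, compl_compl] at h
  exact h

/-- **The disagreement set of two `EXP` languages is in `EXP`** (given a Karp-`EXP`-complete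
`B`): `{y | y ∈ L₁ ↔ y ∉ L₂} = (L₁ ∩ L₂ᶜ) ∪ (L₁ᶜ ∩ L₂)`, the set `L ∆ L(A)` of inputs on which
an algorithm deciding `L₂` errs about `L₁` (printed proof of [ChenEtAl2022], §5.1). [folklore] -/
theorem setOf_iff_not_mem_EXP_of_complete (hB : IsComplete EXP B) {L₁ L₂ : Language Bool}
    (h₁ : L₁ ∈ EXP) (h₂ : L₂ ∈ EXP) : ({y | y ∈ L₁ ↔ y ∉ L₂} : Language Bool) ∈ EXP := by
  have h := union_mem_EXP_of_complete hB
    (inter_mem_EXP_of_complete hB h₁ (compl_mem_EXP_iff.2 h₂))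
    (inter_mem_EXP_of_complete hB (compl_mem_EXP_iff.2 h₁) h₂)
  have he : ({y | y ∈ L₁ ↔ y ∉ L₂} : Language Bool) = (L₁ ⊓ L₂ᶜ) ⊔ (L₁ᶜ ⊓ L₂) := by
    ext y
    show (y ∈ L₁ ↔ y ∉ L₂) ↔ (y ∈ L₁ ∧ y ∉ L₂) ∨ (y ∉ L₁ ∧ y ∈ L₂)
    tauto
  rw [he]
  exact h

end ExpBool

/-! ### The prefix-search language `G` -/

section Pref

variable {B : Language Bool}

/-- **The matrix of the search language**: `⟨⟨u, w⟩, v⟩ ∈ extRel S ↔ |v ++ w| = |u| ∧ v ++ w ∈ S`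
(components read off with the total projections `fstP`, `sndP`).
[cite: ChenEtAl2022, §5.1 (proof of Thm. 5.4, the language `G_A`)] -/
def extRel (S : Language Bool) : Language Bool :=
  {z | (sndP z ++ sndP (fstP z)).length = (fstP (fstP z)).length ∧ sndP z ++ sndP (fstP z) ∈ S}

/-- **The search language `G_S`** (printed `G_A`, with `S = L ∆ L(A)` and suffixes for
prefixes): `⟨u, w⟩ ∈ prefLang S` iff some `v` with `|v ++ w| = |u|` has `v ++ w ∈ S` — "there
is `y ∈ {0,1}ⁿ` extending `w` with `L(y) ≠ A(y)`", `n = |u|`. Literally a polynomially bounded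
`∃` (bound `|v| ≤ |⟨u, w⟩|`) over `extRel S`. [cite: ChenEtAl2022, §5.1 (proof of Thm. 5.4)] -/
def prefLang (S : Language Bool) : Language Bool :=
  {w | ∃ v : List Bool, v.length ≤ w.length ∧ boolPair w v ∈ extRel S}

/-- Membership of a coded triple in `extRel S`. [folklore] -/
theorem boolPair_mem_extRel (S : Language Bool) (u w v : List Bool) :
    boolPair (boolPair u w) v ∈ extRel S ↔ (v ++ w).length = u.length ∧ v ++ w ∈ S := by
  show (sndP (boolPair (boolPair u w) v) ++ sndP (fstP (boolPair (boolPair u w) v))).length =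
      (fstP (fstP (boolPair (boolPair u w) v))).length ∧
    sndP (boolPair (boolPair u w) v) ++ sndP (fstP (boolPair (boolPair u w) v)) ∈ S ↔ _
  simp only [sndP_boolPair, fstP_boolPair]

/-- **Membership of a pair in `prefLang S`**: `⟨u, w⟩ ∈ G_S ↔ ∃ v, |v ++ w| = |u| ∧ v ++ w ∈ S`
(the length bound on `v` is automatic). [cite: ChenEtAl2022, §5.1 (proof of Thm. 5.4)] -/
theorem boolPair_mem_prefLang (S : Language Bool) (u w : List Bool) :
    boolPair u w ∈ prefLang S ↔ ∃ v : List Bool, (v ++ w).length = u.length ∧ v ++ w ∈ S := by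
  constructor
  · rintro ⟨v, -, hv⟩
    exact ⟨v, (boolPair_mem_extRel S u w v).1 hv⟩
  · rintro ⟨v, hl, hS⟩
    refine ⟨v, ?_, (boolPair_mem_extRel S u w v).2 ⟨hl, hS⟩⟩
    have : v.length ≤ (v ++ w).length := by simp
    rw [length_boolPair]
    omega

/-- The recombination map `⟨⟨u, w⟩, v⟩ ↦ ⟨u, v ++ w⟩` is in `FP`. [folklore] -/
theorem extMap_mem_FP :
    fanoutFn (fstP ∘ fstP) (appendFn ∘ fanoutFn sndP (sndP ∘ fstP)) ∈ FP :=
  fanoutFn_mem_FP (comp_mem_FP fstP_mem_FP fstP_mem_FP)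
    (comp_mem_FP appendFn_mem_FP (fanoutFn_mem_FP sndP_mem_FP (comp_mem_FP sndP_mem_FP fstP_mem_FP)))

/-- **`extRel S ∈ EXP` for `S ∈ EXP`**: it is the preimage under `⟨⟨u, w⟩, v⟩ ↦ ⟨u, v ++ w⟩` of
`{⟨u, y⟩ | |y| = |u|} ∩ sndP⁻¹(S)`, an intersection of a `P` language with an `EXP` language
(`inter_mem_EXP_of_complete`). [cite: ChenEtAl2022, §5.1 (proof of Thm. 5.4)] -/
theorem extRel_mem_EXP (hB : IsComplete EXP B) {S : Language Bool} (hS : S ∈ EXP) :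
    extRel S ∈ EXP := by
  have hEq : ({z | (onesFn ∘ sndP) z = (onesFn ∘ fstP) z} : Language Bool) ∈ Classes.P :=
    setOf_apply_eq_apply_mem_P (comp_mem_FP onesFn_mem_FP sndP_mem_FP)
      (comp_mem_FP onesFn_mem_FP fstP_mem_FP)
  have hT : ({z | (onesFn ∘ sndP) z = (onesFn ∘ fstP) z} : Language Bool) ⊓ (sndP ⁻¹' S) ∈ EXP :=
    inter_mem_EXP_of_complete hB (P_subset_EXP hEq) (preimage_mem_EXP_of_mem_FP hS sndP_mem_FP)
  have he : extRel S = fanoutFn (fstP ∘ fstP) (appendFn ∘ fanoutFn sndP (sndP ∘ fstP)) ⁻¹'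
      (({z | (onesFn ∘ sndP) z = (onesFn ∘ fstP) z} : Language Bool) ⊓ (sndP ⁻¹' S)) := by
    ext z
    show (sndP z ++ sndP (fstP z)).length = (fstP (fstP z)).length ∧ sndP z ++ sndP (fstP z) ∈ S ↔
      (onesFn ∘ sndP) (fanoutFn (fstP ∘ fstP) (appendFn ∘ fanoutFn sndP (sndP ∘ fstP)) z) =
          (onesFn ∘ fstP) (fanoutFn (fstP ∘ fstP) (appendFn ∘ fanoutFn sndP (sndP ∘ fstP)) z) ∧
        sndP (fanoutFn (fstP ∘ fstP) (appendFn ∘ fanoutFn sndP (sndP ∘ fstP)) z) ∈ S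
    simp only [fanoutFn_apply, Function.comp_apply, appendFn_boolPair, sndP_boolPair, fstP_boolPair]
    constructor
    · rintro ⟨hl, hs⟩
      exact ⟨by rw [onesFn, onesFn, hl], hs⟩
    · rintro ⟨hl, hs⟩
      refine ⟨?_, hs⟩
      have h := congrArg List.length hl
      rwa [length_onesFn, length_onesFn] at h
  rw [he]
  exact preimage_mem_EXP_of_mem_FP hT extMap_mem_FP

/-- **`G_S ∈ EXP` for `S ∈ EXP`** ("`G_A ∈ (∃ poly(n)) 𝒟 ⊆ 𝒟`"): `prefLang S ∈ ∃ᵖ·EXP` with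
matrix `extRel S` and bound `X`, and `∃ᵖ·EXP ⊆ EXP` (`polyExists_EXP_subset_EXP`).
[cite: ChenEtAl2022, §5.1 (proof of Thm. 5.4)] -/
theorem prefLang_mem_EXP (hB : IsComplete EXP B) {S : Language Bool} (hS : S ∈ EXP) :
    prefLang S ∈ EXP :=
  polyExists_EXP_subset_EXP ⟨extRel S, extRel_mem_EXP hB hS, X, fun w => by rw [eval_X]; rfl⟩

end Pref

/-! ### Padding as a string function -/

/-- **The padding map as an `FP` string function**: `padStr pad ⟨x, r⟩ = pad (x, |r|)` (any
second component of the right length serves as the unary argument).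
[cite: ChenEtAl2022, §5.1 ("since `L` is paddable …")] -/
def padStr (pad : List Bool × ℕ → List Bool) : List Bool → List Bool :=
  fun w => pad ((boolUnpair w).1, (boolUnpair w).2.length)

/-- Value of `padStr` on a pair. [folklore] -/
@[simp] theorem padStr_boolPair (pad : List Bool × ℕ → List Bool) (x r : List Bool) :
    padStr pad (boolPair x r) = pad (x, r.length) := by
  simp [padStr]

/-- `padStr pad ∈ FP` when `pad` is polynomial time on `⟨x, 1ᵐ⟩` (`mem_FP_of_unaryArg`:
normalise the second component, then run the padding machine).
[cite: ChenEtAl2022, §5.1 ("since `L` is paddable …")] -/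
theorem padStr_mem_FP {pad : List Bool × ℕ → List Bool}
    (hpad : PolyTimeComputable (fun p : List Bool × ℕ => boolPair p.1 (unaryEncodeNat p.2))
      (id : List Bool → List Bool) pad) : padStr pad ∈ FP := by
  have hu : Function.uncurry (fun (x : List Bool) (m : ℕ) => pad (x, m)) = pad := by
    funext q
    rfl
  have h := mem_FP_of_unaryArg (eb := (id : List Bool → List Bool))
    (f := fun (x : List Bool) (m : ℕ) => pad (x, m)) (by rw [hu]; exact hpad)
  exact h

/-- Iterated `cons` has the obvious length. [folklore] -/
theorem length_iterate_cons (b : Bool) (k : ℕ) (w : List Bool) :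
    ((List.cons b)^[k] w).length = w.length + k := by
  induction k with
  | zero => rfl
  | succ k ih => rw [Function.iterate_succ_apply', List.length_cons, ih]; rfl

/-- Iterated `cons` is in `FP`. [folklore] -/
theorem iterate_cons_mem_FP (b : Bool) : ∀ k : ℕ, (fun w : List Bool => (List.cons b)^[k] w) ∈ FP
  | 0 => PolyTimeComputable.id _
  | k + 1 => by
    have he : (fun w : List Bool => (List.cons b)^[k + 1] w) =
        List.cons b ∘ fun w : List Bool => (List.cons b)^[k] w := by
      funext w
      rw [Function.comp_apply, Function.iterate_succ_apply']
    rw [he]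
    exact comp_mem_FP (cons_mem_FP b) (iterate_cons_mem_FP b k)

/-! ### Infinitely many bad input lengths -/

/-- **Bad input lengths are infinitely many.** If `EXP ⊄ BPP`, `L` is `EXP`-complete and
length-paddable, and `L'' ∈ BPP` (the language of the refuted algorithm `A`), then for infinitely
many `n` some `n`-bit string lies in `L ∆ L''` ("let `n` be an input length such that `A` does
not correctly solve `L` on all `n`-bit inputs; since `𝒟 ⊄ 𝒞`, there are infinitely many such
input lengths"). Proof: if `L` and `L''` agreed at all lengths `≥ n₀`, then for every
`L₁ ∈ EXP` with reduction `f` to `L` the padded map `x ↦ pad(f x, |f x| + n₀)` would Karp-reduce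
`L₁` to `L''`, so `EXP ⊆ BPP` (`mem_BPP_of_karpReducible`).
[cite: ChenEtAl2022, §5.1 (proof of Thm. 5.4)] -/
theorem frequently_exists_mismatch (hEXP : ¬ EXP ⊆ BPP) {L L'' : Language Bool}
    (hL : IsComplete EXP L) (hpad : IsLengthPaddable L) (hL'' : L'' ∈ BPP) :
    ∃ᶠ n in atTop, ∃ y : List Bool, y.length = n ∧ (y ∈ L ↔ y ∉ L'') := by
  by_contra hnot
  rw [Filter.not_frequently, Filter.eventually_atTop] at hnot
  obtain ⟨n₀, hn₀⟩ := hnot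
  have hagree : ∀ y : List Bool, n₀ ≤ y.length → (y ∈ L ↔ y ∈ L'') := by
    intro y hy
    have h := hn₀ y.length hy
    push Not at h
    have h' := h y rfl
    tauto
  obtain ⟨pad, hpadc, hpads⟩ := hpad
  apply hEXP
  intro L₁ hL₁
  obtain ⟨f, hf, hfL⟩ := hL.2 L₁ hL₁
  set g : List Bool → List Bool :=
    padStr pad ∘ fanoutFn id (fun w : List Bool => (List.cons true)^[n₀] w) ∘ f with hg
  have hgFP : g ∈ FP :=
    comp_mem_FP (padStr_mem_FP hpadc)
      (comp_mem_FP (fanoutFn_mem_FP (PolyTimeComputable.id _) (iterate_cons_mem_FP true n₀)) hf)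
  have hgval : ∀ x, g x = pad (f x, (f x).length + n₀) := fun x => by
    simp only [hg, Function.comp_apply, fanoutFn_apply, id, padStr_boolPair, length_iterate_cons]
  refine mem_BPP_of_karpReducible ⟨g, hgFP, fun x => ?_⟩ hL''
  obtain ⟨hlen, hmem⟩ := hpads (f x) ((f x).length + n₀) (Nat.le_add_right _ _)
  rw [hfL x, hgval x]
  exact hmem.symm.trans (hagree _ (by rw [hlen]; exact Nat.le_add_left _ _))

end Literature.Computability.MetaComplexity
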